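/-
Copyright (c) 2026 the pub-hodgecm-mathlib formalisation cell (harness21).  Prover seat hodgecm-mathlib-A-p12 (g35): P6b wave A seat 1 «FFGS-QUOT» (A), §E
part 2 «THE AFFINE QUOTIENT: FINITENESS AND FAITHFUL FLATNESS OVER THE INVARIANTS» (dealer desk F0P6b-plan (g13) DEAL P6b-A1, director g34 s1734; box
F0P6-ref1 (g8)), 2026-09-03.
-/
import Literature.AlgebraicGeometry.GroupSchemes.FiniteFlatGroupSchemeQuotientAffineLocal
import Literature.AlgebraicGeometry.GroupSchemes.FiniteFlatGroupSchemeQuotientAffineBaseChange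
import Mathlib.RingTheory.Localization.AtPrime.Basic
import Mathlib.RingTheory.Polynomial.Quotient
import Mathlib.RingTheory.Flat.Localization
import Mathlib.RingTheory.Flat.Stability
import Mathlib.RingTheory.LocalRing.ResidueField.Basic
import Mathlib.RingTheory.LocalRing.RingHom.Basic
import Mathlib.RingTheory.IsTensorProduct
import HarnessLib

/-!
# Quotient of an affine scheme by a free action of a finite locally free group scheme: `X → X ⧸ Z` is finite and faithfully flat

Topic `AlgebraicGeometry/GroupSchemes`; namespace `Literature.AlgebraicGeometry.GroupSchemes.FiniteFlatQuotientAffine` (sub-namespace = the object);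
THEOREMS ONLY (no definition, instance, notation or named fact); Mathlib-footed over §A–§D and §E.1 of the organ (`…QuotientAffineTwist`,
`…Integral`, `…BasisCriterion`, `…Local`, `…BaseChange`).  Cell `pub/hodgecm-mathlib` (D-0151), organ «FFGS-QUOT» (A) of the P6b fan-out sheet (desk
F0P6b-plan (g13) `SOCKETS-P6b.fanout.v1` §0; signature sheet `WAVEA-SIGNATURES.v2` `sig_FFGSQ_A_torsorOverInvariants`), lane
`--supports stmt-HodgeConjecture-24832`; count-neutral (banked Row-4B capital).  HC_CM is proved only modulo the printed citations (2 remaining named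
inputs hLiu418 = `stmt-HodgeConjecture-24832`, h413 = `stmt-HodgeConjecture-24833`) until rung 0 closes.

THE THEOREM ([MumfordAV1970] §12 Thm. 1 (A) «`π : X → Y = Spec C₀` is finite, locally free (faithfully flat)»; [SGA3I] Exp. V Thm. 4.1 (ii)+(iv); [StacksProject]
Tag 03BM first half).  `R` a commutative ring, `H` a commutative Hopf algebra FINITE FREE over `R` (`Spec H = Z`), `C` a commutative `R`-algebra OF FINITE
TYPE (`Spec C = X`) with a coassociative counital coaction `ρ : C →ₐ[R] C ⊗[R] H` (`hcoassoc`, `hcounit` in the signature sheet's element-wise form) which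
is FREE (`hfree`: the Galois map `productMap includeLeft ρ : C ⊗[R] C → C ⊗[R] H` is onto); `C₀ := AlgHom.equalizer ρ includeLeft` the invariants.  THEN
* `flat_invariants` — `C` is FLAT over `C₀`;
* `faithfullyFlat_invariants` — `C` is FAITHFULLY FLAT over `C₀`;
* `finite_faithfullyFlat_invariants` — **`Module.Finite C₀ C ∧ Module.FaithfullyFlat C₀ C`** = conjuncts 1–2 of `sig_FFGSQ_A_torsorOverInvariants` with
  the sheet's `[Module.Finite R H] [Module.Flat R H] [IsNoetherianRing R]` replaced by `[Module.Free R H] [Module.Finite R H]` (all P6b consumers: `H` finite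
  flat over an Artinian local ring or a field is free; no Noetherian hypothesis is needed) and the budgeted `[Algebra.FiniteType R C]` added.
  Conjunct 3 (the torsor clause `ker θ = ⟨c ⊗ 1 − 1 ⊗ c⟩`) is ★ in the LOCAL case (§D `free_faithfullyFlat_ker_of_isLocalRing`); its globalisation is the
  remaining §E.3.

THE PROOF (Stacks 03BM, first half, in ring form).  Flatness is local: it suffices that `C_𝔪 = LocalizedModule 𝔪.primeCompl C` is `C₀`-flat for every
maximal `𝔪 ⊂ C₀` (Mathlib `Module.flat_of_localized_maximal`).  THE AUXILIARY RING (`exists_localization_polynomial_infinite_residueField`):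
`B := C₀[X]_{𝔪[X]}` (`Localization.AtPrime (𝔪.map Polynomial.C)`) is local, FLAT over `C₀` (polynomial + localization), has INFINITE residue field (it
contains `(C₀⧸𝔪)[X]`, Mathlib `Ideal.polynomialQuotientEquivQuotientPolynomial`, `Localization.AtPrime.under_maximalIdeal`), and receives a LOCAL homomorphism
`g` from `(C₀)_𝔪` over `C₀` (`Localization.localRingHom`).  Over `B` (§E.1): the base-changed coaction `ρ'` on `C' := B ⊗[C₀] C` is coassociative, counital,
free, with invariants `≅ B` (`exists_ringEquiv_equalizer_baseChange`; flat base change), hence local with infinite residue field, and `C'` is finite over `B`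
hence semilocal (★ `Literature.RingTheory.OrderOfVanishing.finite_maximalSpectrum`); §D (`free_faithfullyFlat_ker_of_isLocalRing`) makes `C'` FREE over its
invariants, i.e. over `B` (`free_of_free_equalizer_baseChange`, Mathlib `Module.Basis.mapCoeffs`).  DESCENT (`flat_localizedModule_of_flat_tensorProduct`,
generic): `B` is faithfully flat over `(C₀)_𝔪` (flat by `Module.flat_iff_of_isLocalization`, faithful because `g` is local) and
`B ⊗[(C₀)_𝔪] C_𝔪 ≅ B ⊗[C₀] C` (`IsLocalizedModule.isBaseChange`, `AlgebraTensorModule.cancelBaseChange`), so `C_𝔪` is flat over `(C₀)_𝔪`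
(`Module.Flat.of_flat_tensorProduct`) and over `C₀` (`Module.Flat.trans`).  FAITHFUL: `C` is integral over `C₀` (§B), so every maximal `𝔪` has a prime of `C`
above it (`Ideal.exists_ideal_over_maximal_of_isIntegral`) and `𝔪C ≠ C`.  FINITE: §B `finite_invariants`.

## References
* [MumfordAV1970] D. Mumford, *Abelian Varieties* (1970), §12 «Quotients by finite group schemes», Thm. 1 (A) p. 111 and its proof pp. 112–115.
* [SGA3I] M. Demazure, A. Grothendieck (eds.), *SGA 3, Tome I*, Exp. V (P. Gabriel), Thm. 4.1 (ii) «`p` est entier», (iv) «si `(d₀, d₁)` est un couple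
  d'équivalence … `p : X₀ → Y` est fini localement libre» (re-edition p. 165 ∕ orig. p. 263).
* [StacksProject] The Stacks Project, Tag 03BM (Prop. 39.23.9) and its proof (flat local base change to an infinite residue field, `A` semi-local, general
  position, Lemma 03C8, descent), Tag 03BK (base change of the groupoid).
-/

set_option autoImplicit false

namespace Literature.AlgebraicGeometry.GroupSchemes.FiniteFlatQuotientAffine

open TensorProduct Polynomial

/-! ## §E.2  The auxiliary local ring `C₀[X]_{𝔪[X]}`, descent, and the theorem -/

section AuxRing

variable (A : Type*) [CommRing A] (𝔪 : Ideal A) [𝔪.IsMaximal]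

omit [𝔪.IsMaximal] in
/-- `(𝔪·A[X]).comap C = 𝔪`: the constants of the extended ideal `𝔪[X]` are `𝔪` (Mathlib `Ideal.mem_map_C_iff`). [cite: StacksProject, Tag 03BM] -/
theorem comap_C_map_C_eq : (Ideal.map (Polynomial.C : A →+* A[X]) 𝔪).comap Polynomial.C = 𝔪 := by
  ext a
  rw [Ideal.mem_comap, Ideal.mem_map_C_iff]
  constructor
  · intro h; simpa using h 0
  · intro h n
    rw [Polynomial.coeff_C]
    split_ifs
    · exact h
    · exact 𝔪.zero_mem

/-- **The auxiliary local ring `A[X]_{𝔪[X]}`** ([StacksProject] Tag 03BM proof: «the local ring maps `C_𝔭 → C'_𝔭` we are going to use are any local flat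
ring maps such that the residue field of `C'_𝔭` is infinite; by Algebra Lemma 10.159.1 such local ring maps exist»): for a maximal ideal `𝔪` of `A`, the
localization of `A[X]` at the prime `𝔪[X]` is FLAT over `A`, has INFINITE residue field (containing `(A⧸𝔪)[X]`), and receives a LOCAL homomorphism `g` from
`A_𝔪` with `g ∘ (A → A_𝔪) = (A → A[X]_{𝔪[X]})` (Mathlib `Localization.localRingHom`). [cite: StacksProject, Tag 03BM] -/
theorem exists_localization_polynomial_infinite_residueField :
    letI : (Ideal.map (Polynomial.C : A →+* A[X]) 𝔪).IsPrime := Ideal.isPrime_map_C_of_isPrime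
    Module.Flat A (Localization.AtPrime (Ideal.map (Polynomial.C : A →+* A[X]) 𝔪)) ∧
    Infinite (IsLocalRing.ResidueField (Localization.AtPrime (Ideal.map (Polynomial.C : A →+* A[X]) 𝔪))) ∧
    ∃ g : Localization.AtPrime 𝔪 →+* Localization.AtPrime (Ideal.map (Polynomial.C : A →+* A[X]) 𝔪),
      IsLocalHom g ∧ g.comp (algebraMap A (Localization.AtPrime 𝔪)) =
        algebraMap A (Localization.AtPrime (Ideal.map (Polynomial.C : A →+* A[X]) 𝔪)) := by
  set P : Ideal A[X] := Ideal.map (Polynomial.C : A →+* A[X]) 𝔪 with hP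
  haveI hPp : P.IsPrime := Ideal.isPrime_map_C_of_isPrime
  refine ⟨?_, ?_, ?_⟩
  · -- flat: A → A[X] free, A[X] → localization flat
    haveI : Module.Flat A[X] (Localization.AtPrime P) := IsLocalization.flat _ P.primeCompl
    exact Module.Flat.trans A A[X] (Localization.AtPrime P)
  · -- infinite residue field: (A ⧸ 𝔪)[X] embeds
    letI : Field (A ⧸ 𝔪) := Ideal.Quotient.field 𝔪
    have hcomap : (IsLocalRing.maximalIdeal (Localization.AtPrime P)).comap
        (algebraMap A[X] (Localization.AtPrime P)) = P := Localization.AtPrime.under_maximalIdeal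
    let q : A[X] ⧸ P →+* IsLocalRing.ResidueField (Localization.AtPrime P) :=
      Ideal.quotientMap (IsLocalRing.maximalIdeal (Localization.AtPrime P))
        (algebraMap A[X] (Localization.AtPrime P)) hcomap.ge
    have hq : Function.Injective q := Ideal.quotientMap_injective' hcomap.le
    let e : (A ⧸ 𝔪)[X] ≃+* A[X] ⧸ P := Ideal.polynomialQuotientEquivQuotientPolynomial 𝔪
    exact Infinite.of_injective (q ∘ e) (hq.comp e.injective)
  · refine ⟨Localization.localRingHom 𝔪 P (Polynomial.C : A →+* A[X]) (comap_C_map_C_eq A 𝔪).symm,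
      inferInstance, ?_⟩
    ext a
    simp only [RingHom.comp_apply, Localization.localRingHom_to_map]
    change _ = algebraMap A (Localization.AtPrime P) a
    rw [IsScalarTower.algebraMap_apply A A[X] (Localization.AtPrime P), Polynomial.algebraMap_eq]

/-- **Descent of flatness through a local flat extension of `A_𝔪`** (the «this implies that `C → A` is flat, by combining Algebra Lemmas 39.17, 39.18 and 39.8»
step of [StacksProject] Tag 03BM): if `B` is a local ring, flat over `A`, receiving a LOCAL homomorphism `g : A_𝔪 → B` over `A`, and `B ⊗[A] M` is `B`-flat,
then the localization `M_𝔪` is `A`-flat — `B` is faithfully flat over `A_𝔪` (Mathlib `Module.flat_iff_of_isLocalization`, `IsLocalRing.map_maximalIdeal_le`),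
`B ⊗[A_𝔪] M_𝔪 ≅ B ⊗[A] M` (`IsLocalizedModule.isBaseChange`, `AlgebraTensorModule.cancelBaseChange`), faithfully flat descent `Module.Flat.of_flat_tensorProduct`,
and `Module.Flat.trans`. [cite: StacksProject, Tag 03BM] -/
theorem flat_localizedModule_of_flat_tensorProduct
    {A : Type*} [CommRing A] (𝔪 : Ideal A) [𝔪.IsMaximal]
    (M : Type*) [AddCommGroup M] [Module A M]
    (B : Type*) [CommRing B] [Algebra A B] [IsLocalRing B] [Module.Flat A B]
    (g : Localization.AtPrime 𝔪 →+* B) [IsLocalHom g]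
    (hg : g.comp (algebraMap A (Localization.AtPrime 𝔪)) = algebraMap A B)
    [Module.Flat B (B ⊗[A] M)] :
    Module.Flat A (LocalizedModule 𝔪.primeCompl M) := by
  set L := Localization.AtPrime 𝔪 with hL
  letI : Algebra L B := g.toAlgebra
  haveI : IsScalarTower A L B := IsScalarTower.of_algebraMap_eq fun a => by
    rw [RingHom.algebraMap_toAlgebra, ← RingHom.comp_apply, hg]
  haveI : Module.Flat L B := (Module.flat_iff_of_isLocalization L 𝔪.primeCompl B).2 inferInstance
  haveI : Module.FaithfullyFlat L B := by
    rw [Module.FaithfullyFlat.iff_flat_and_proper_ideal]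
    refine ⟨inferInstance, fun I hI htop => ?_⟩
    rw [Ideal.smul_top_eq_map] at htop
    have h1 : I.map (algebraMap L B) ≤ IsLocalRing.maximalIdeal B :=
      (Ideal.map_mono (IsLocalRing.le_maximalIdeal hI)).trans
        (by rw [RingHom.algebraMap_toAlgebra]; exact IsLocalRing.map_maximalIdeal_le g)
    have h2 : I.map (algebraMap L B) = ⊤ := by
      have := congr_arg (fun N : Submodule L B => (N : Set B)) htop
      simpa using this
    exact (IsLocalRing.maximalIdeal.isMaximal B).ne_top (top_le_iff.1 (h2 ▸ h1))
  -- `L ⊗[A] M` is the localized module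
  set Mₚ := LocalizedModule 𝔪.primeCompl M with hMₚ
  have hbc : IsBaseChange L (LocalizedModule.mkLinearMap 𝔪.primeCompl M) :=
    IsLocalizedModule.isBaseChange 𝔪.primeCompl L _
  -- `B ⊗[L] Mₚ ≃ B ⊗[A] M` (B-linear)
  let e : B ⊗[L] Mₚ ≃ₗ[B] B ⊗[A] M :=
    (TensorProduct.AlgebraTensorModule.congr (LinearEquiv.refl B B) hbc.equiv.symm).trans
      (TensorProduct.AlgebraTensorModule.cancelBaseChange A L B B M)
  haveI : Module.Flat B (B ⊗[L] Mₚ) := Module.Flat.of_linearEquiv e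
  haveI : Module.Flat L Mₚ := Module.Flat.of_flat_tensorProduct L Mₚ B
  exact Module.Flat.trans A L Mₚ

end AuxRing

section Assembly

open Algebra.TensorProduct

variable {R : Type*} [CommRing R] {H : Type*} [CommRing H] [HopfAlgebra R H]
  {C : Type*} [CommRing C] [Algebra R C] (ρ : C →ₐ[R] C ⊗[R] H)
  (C₀ : Subalgebra R C) (B : Type*) [CommRing B] [Algebra R B] [Algebra C₀ B] [IsScalarTower R C₀ B]
  (ρ' : B ⊗[C₀] C →ₐ[R] (B ⊗[C₀] C) ⊗[R] H)

/-- For a FLAT `C₀`-algebra `B` with `C₀ → C` injective, `B` is ring-isomorphic to the invariants `AlgHom.equalizer ρ' includeLeft` of the base-changed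
coaction, compatibly with `B → B ⊗[C₀] C` (§E.1 `equalizer_coaction_baseChange_eq_range` + Mathlib `Algebra.TensorProduct.includeLeft_injective`; [StacksProject]
Tag 03BK (3)). [cite: StacksProject, Tag 03BK] -/
theorem exists_ringEquiv_equalizer_baseChange [Module.Flat C₀ B]
    (hE : AlgHom.equalizer ρ'
        (Algebra.TensorProduct.includeLeft : B ⊗[C₀] C →ₐ[R] (B ⊗[C₀] C) ⊗[R] H) =
      (IsScalarTower.toAlgHom R B (B ⊗[C₀] C)).range) :
    ∃ e : B ≃+* AlgHom.equalizer ρ'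
        (Algebra.TensorProduct.includeLeft : B ⊗[C₀] C →ₐ[R] (B ⊗[C₀] C) ⊗[R] H),
      ∀ b : B, ((e b : AlgHom.equalizer ρ'
        (Algebra.TensorProduct.includeLeft : B ⊗[C₀] C →ₐ[R] (B ⊗[C₀] C) ⊗[R] H)) : B ⊗[C₀] C) =
        algebraMap B (B ⊗[C₀] C) b := by
  have hinj : Function.Injective (algebraMap B (B ⊗[C₀] C)) :=
    Algebra.TensorProduct.includeLeft_injective (R := C₀) (A := B) (B := C) (S := B)
      (fun a b h => Subtype.ext h)
  let φ : B →ₐ[R] AlgHom.equalizer ρ'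
      (Algebra.TensorProduct.includeLeft : B ⊗[C₀] C →ₐ[R] (B ⊗[C₀] C) ⊗[R] H) :=
    (IsScalarTower.toAlgHom R B (B ⊗[C₀] C)).codRestrict _ (fun b => by rw [hE]; exact ⟨b, rfl⟩)
  have hφv : ∀ b : B, ((φ b : AlgHom.equalizer ρ'
      (Algebra.TensorProduct.includeLeft : B ⊗[C₀] C →ₐ[R] (B ⊗[C₀] C) ⊗[R] H)) : B ⊗[C₀] C) =
      algebraMap B (B ⊗[C₀] C) b := fun b => rfl
  have hφ : Function.Bijective φ := by
    refine ⟨fun b₁ b₂ h => hinj ?_, fun y => ?_⟩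
    · rw [← hφv, ← hφv, h]
    · have hy : (y : B ⊗[C₀] C) ∈ (IsScalarTower.toAlgHom R B (B ⊗[C₀] C)).range := hE ▸ y.2
      obtain ⟨b, hb⟩ := hy
      exact ⟨b, Subtype.ext hb⟩
  exact ⟨RingEquiv.ofBijective φ.toRingHom hφ, fun b => hφv b⟩

/-- Transport of freeness along the ring isomorphism `B ≅ AlgHom.equalizer ρ' includeLeft` (the two module structures on `B ⊗[C₀] C` agree:
`b • x = (b ⊗ 1) · x`; Mathlib `Module.Basis.mapCoeffs`). [cite: StacksProject, Tag 03BM] -/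
theorem free_of_free_equalizer_baseChange
    (e : B ≃+* AlgHom.equalizer ρ'
        (Algebra.TensorProduct.includeLeft : B ⊗[C₀] C →ₐ[R] (B ⊗[C₀] C) ⊗[R] H))
    (he : ∀ b : B, ((e b : AlgHom.equalizer ρ'
        (Algebra.TensorProduct.includeLeft : B ⊗[C₀] C →ₐ[R] (B ⊗[C₀] C) ⊗[R] H)) : B ⊗[C₀] C) =
        algebraMap B (B ⊗[C₀] C) b)
    [Module.Free (AlgHom.equalizer ρ'
        (Algebra.TensorProduct.includeLeft : B ⊗[C₀] C →ₐ[R] (B ⊗[C₀] C) ⊗[R] H)) (B ⊗[C₀] C)] :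
    Module.Free B (B ⊗[C₀] C) := by
  let bE := Module.Free.chooseBasis (AlgHom.equalizer ρ'
      (Algebra.TensorProduct.includeLeft : B ⊗[C₀] C →ₐ[R] (B ⊗[C₀] C) ⊗[R] H)) (B ⊗[C₀] C)
  have hsmul : ∀ (c : AlgHom.equalizer ρ'
      (Algebra.TensorProduct.includeLeft : B ⊗[C₀] C →ₐ[R] (B ⊗[C₀] C) ⊗[R] H)) (x : B ⊗[C₀] C),
      e.symm c • x = c • x := by
    intro c x
    obtain ⟨b, rfl⟩ := e.surjective c
    rw [e.symm_apply_apply, Subalgebra.smul_def, he, Algebra.TensorProduct.algebraMap_apply, Algebra.algebraMap_self,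
      RingHom.id_apply]
    -- `b • x = (b ⊗ 1) • x = (b ⊗ 1) * x`
    induction x using TensorProduct.induction_on with
    | zero => simp
    | tmul b' c => rw [TensorProduct.smul_tmul', smul_eq_mul, smul_eq_mul, Algebra.TensorProduct.tmul_mul_tmul, one_mul]
    | add u v hu hv => rw [smul_add, smul_add, hu, hv]
  exact Module.Free.of_basis (bE.mapCoeffs e.symm hsmul)

end Assembly

section Main

open Algebra.TensorProduct

variable {R : Type*} [CommRing R] {H : Type*} [CommRing H] [HopfAlgebra R H] [Module.Free R H] [Module.Finite R H]
  {C : Type*} [CommRing C] [Algebra R C] (ρ : C →ₐ[R] C ⊗[R] H)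

/-- **The local step of [StacksProject] Tag 03BM over an abstract auxiliary ring**: `H` finite free, `C` finite over its invariants `C₀`, the coaction
coassociative, counital and free; `B` a local FLAT `C₀`-algebra with INFINITE residue field receiving a local homomorphism from `(C₀)_𝔪` over `C₀`.  Then
`C_𝔪` is flat over `C₀`: base change the coaction to `C' = B ⊗[C₀] C` (§E.1), identify its invariants with `B`, apply §D (`C'` free over `B`) and descend
(`flat_localizedModule_of_flat_tensorProduct`). [cite: StacksProject, Tag 03BM] -/
theorem flat_localizedModule_invariants_of_aux
    [Module.Finite (AlgHom.equalizer ρ (Algebra.TensorProduct.includeLeft : C →ₐ[R] C ⊗[R] H)) C]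
    (hcoassoc : ∀ c : C, TensorProduct.map LinearMap.id (Coalgebra.comul (R := R) (A := H)) (ρ c) =
      TensorProduct.assoc R C H H (TensorProduct.map ρ.toLinearMap LinearMap.id (ρ c)))
    (hcounit : ∀ c : C, TensorProduct.rid R C
      (TensorProduct.map LinearMap.id (Coalgebra.counit (R := R) (A := H)) (ρ c)) = c)
    (hfree : Function.Surjective
      (Algebra.TensorProduct.productMap (Algebra.TensorProduct.includeLeft : C →ₐ[R] C ⊗[R] H) ρ))
    (𝔪 : Ideal (AlgHom.equalizer ρ (Algebra.TensorProduct.includeLeft : C →ₐ[R] C ⊗[R] H))) [𝔪.IsMaximal]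
    (B : Type*) [CommRing B] [Algebra R B]
    [Algebra (AlgHom.equalizer ρ (Algebra.TensorProduct.includeLeft : C →ₐ[R] C ⊗[R] H)) B]
    [IsScalarTower R (AlgHom.equalizer ρ (Algebra.TensorProduct.includeLeft : C →ₐ[R] C ⊗[R] H)) B]
    [IsLocalRing B] [Infinite (IsLocalRing.ResidueField B)]
    [Module.Flat (AlgHom.equalizer ρ (Algebra.TensorProduct.includeLeft : C →ₐ[R] C ⊗[R] H)) B]
    (g : Localization.AtPrime 𝔪 →+* B) [IsLocalHom g]
    (hg : g.comp (algebraMap (AlgHom.equalizer ρ (Algebra.TensorProduct.includeLeft : C →ₐ[R] C ⊗[R] H))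
        (Localization.AtPrime 𝔪)) =
      algebraMap (AlgHom.equalizer ρ (Algebra.TensorProduct.includeLeft : C →ₐ[R] C ⊗[R] H)) B) :
    Module.Flat (AlgHom.equalizer ρ (Algebra.TensorProduct.includeLeft : C →ₐ[R] C ⊗[R] H))
      (LocalizedModule 𝔪.primeCompl C) := by
  have hinv : ∀ b ∈ (AlgHom.equalizer ρ (Algebra.TensorProduct.includeLeft : C →ₐ[R] C ⊗[R] H)), ρ b = b ⊗ₜ[R] (1 : H) := fun b hb => (AlgHom.mem_equalizer _ _ _).1 hb
  have hinv' : ∀ c : C, ρ c = c ⊗ₜ[R] (1 : H) → c ∈ (AlgHom.equalizer ρ (Algebra.TensorProduct.includeLeft : C →ₐ[R] C ⊗[R] H)) := fun c hc => (AlgHom.mem_equalizer _ _ _).2 hc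
  obtain ⟨ρ', hρ'⟩ := exists_coaction_baseChange ρ (AlgHom.equalizer ρ (Algebra.TensorProduct.includeLeft : C →ₐ[R] C ⊗[R] H)) hinv B
  have hco' := coassoc_coaction_baseChange ρ (AlgHom.equalizer ρ (Algebra.TensorProduct.includeLeft : C →ₐ[R] C ⊗[R] H)) B ρ' hρ' hcoassoc
  have hcu' := counit_coaction_baseChange ρ (AlgHom.equalizer ρ (Algebra.TensorProduct.includeLeft : C →ₐ[R] C ⊗[R] H)) B ρ' hρ' hcounit
  have hfr' := surjective_productMap_coaction_baseChange ρ (AlgHom.equalizer ρ (Algebra.TensorProduct.includeLeft : C →ₐ[R] C ⊗[R] H)) B ρ' hρ' hfree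
  have hE := equalizer_coaction_baseChange_eq_range ρ (AlgHom.equalizer ρ (Algebra.TensorProduct.includeLeft : C →ₐ[R] C ⊗[R] H)) hinv B ρ' hρ' hinv'
  obtain ⟨e, he⟩ := exists_ringEquiv_equalizer_baseChange (AlgHom.equalizer ρ (Algebra.TensorProduct.includeLeft : C →ₐ[R] C ⊗[R] H)) B ρ' hE
  haveI : Nontrivial (AlgHom.equalizer ρ'
      (Algebra.TensorProduct.includeLeft : B ⊗[(AlgHom.equalizer ρ (Algebra.TensorProduct.includeLeft : C →ₐ[R] C ⊗[R] H))] C →ₐ[R] (B ⊗[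
      (AlgHom.equalizer ρ (Algebra.TensorProduct.includeLeft : C →ₐ[R] C ⊗[R] H))] C) ⊗[R] H)) := e.injective.nontrivial
  haveI : IsLocalHom e.toRingHom := ⟨fun a ha => (MulEquiv.isUnit_map e).1 ha⟩
  haveI : IsLocalRing (AlgHom.equalizer ρ'
      (Algebra.TensorProduct.includeLeft : B ⊗[(AlgHom.equalizer ρ (Algebra.TensorProduct.includeLeft : C →ₐ[R] C ⊗[R] H))] C →ₐ[R] (B ⊗[
      (AlgHom.equalizer ρ (Algebra.TensorProduct.includeLeft : C →ₐ[R] C ⊗[R] H))] C) ⊗[R] H)) :=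
    IsLocalRing.of_surjective e.toRingHom e.surjective
  haveI : Infinite (IsLocalRing.ResidueField (AlgHom.equalizer ρ'
      (Algebra.TensorProduct.includeLeft : B ⊗[(AlgHom.equalizer ρ (Algebra.TensorProduct.includeLeft : C →ₐ[R] C ⊗[R] H))] C →ₐ[R] (B ⊗[
      (AlgHom.equalizer ρ (Algebra.TensorProduct.includeLeft : C →ₐ[R] C ⊗[R] H))] C) ⊗[R] H))) :=
    Infinite.of_injective _ (IsLocalRing.ResidueField.mapEquiv e).injective
  haveI : Finite (MaximalSpectrum (B ⊗[(AlgHom.equalizer ρ (Algebra.TensorProduct.includeLeft : C →ₐ[R] C ⊗[R] H))] C)) :=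
    Literature.RingTheory.OrderOfVanishing.finite_maximalSpectrum B (B ⊗[(AlgHom.equalizer ρ (Algebra.TensorProduct.includeLeft : C →ₐ[R] C ⊗[R] H))] C)
  obtain ⟨hfreeE, -, -, -⟩ := free_faithfullyFlat_ker_of_isLocalRing ρ' hco' hcu' hfr'
  haveI : Module.Free B (B ⊗[(AlgHom.equalizer ρ (Algebra.TensorProduct.includeLeft : C →ₐ[R] C ⊗[R] H))] C) := free_of_free_equalizer_baseChange
      (AlgHom.equalizer ρ (Algebra.TensorProduct.includeLeft : C →ₐ[R] C ⊗[R] H)) B ρ' e he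
  haveI : Module.Flat B (B ⊗[(AlgHom.equalizer ρ (Algebra.TensorProduct.includeLeft : C →ₐ[R] C ⊗[R] H))] C) := Module.Flat.of_free
  exact flat_localizedModule_of_flat_tensorProduct 𝔪 C B g hg

/-- **`X → X ⧸ Z` IS FLAT**: for `H` finite free, `C` of finite type over `R` with a coassociative counital FREE coaction, `C` is flat over the invariants
`C₀ = AlgHom.equalizer ρ includeLeft` — locality of flatness (Mathlib `Module.flat_of_localized_maximal`) + the local step over `C₀[X]_{𝔪[X]}`
([MumfordAV1970] §12 Thm. 1 (A); [SGA3I] V 4.1 (iv); [StacksProject] Tag 03BM). [cite: MumfordAV1970, §12 Thm. 1 (A) p. 111] -/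
theorem flat_invariants [Algebra.FiniteType R C]
    (hcoassoc : ∀ c : C, TensorProduct.map LinearMap.id (Coalgebra.comul (R := R) (A := H)) (ρ c) =
      TensorProduct.assoc R C H H (TensorProduct.map ρ.toLinearMap LinearMap.id (ρ c)))
    (hcounit : ∀ c : C, TensorProduct.rid R C
      (TensorProduct.map LinearMap.id (Coalgebra.counit (R := R) (A := H)) (ρ c)) = c)
    (hfree : Function.Surjective
      (Algebra.TensorProduct.productMap (Algebra.TensorProduct.includeLeft : C →ₐ[R] C ⊗[R] H) ρ)) :
    Module.Flat (AlgHom.equalizer ρ (Algebra.TensorProduct.includeLeft : C →ₐ[R] C ⊗[R] H)) C := by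
  haveI : Module.Finite (AlgHom.equalizer ρ (Algebra.TensorProduct.includeLeft : C →ₐ[R] C ⊗[R] H)) C :=
    finite_invariants ρ hcoassoc hcounit
  apply Module.flat_of_localized_maximal
  intro 𝔪 h𝔪
  haveI hP : (Ideal.map (Polynomial.C : _ →+* Polynomial _) 𝔪).IsPrime := Ideal.isPrime_map_C_of_isPrime
  obtain ⟨hflat, hinf, g, hgloc, hg⟩ := exists_localization_polynomial_infinite_residueField _ 𝔪
  haveI := hflat
  haveI := hinf
  haveI := hgloc
  exact flat_localizedModule_invariants_of_aux ρ hcoassoc hcounit hfree 𝔪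
    (Localization.AtPrime (Ideal.map (Polynomial.C : _ →+* Polynomial _) 𝔪)) g hg

/-- **`X → X ⧸ Z` IS FAITHFULLY FLAT** (conjunct 2 of «FFGS-QUOT» (A)): flat (`flat_invariants`) and `𝔪C ≠ C` for every maximal `𝔪 ⊂ C₀` because `C` is
integral over `C₀` (§B, lying over: Mathlib `Ideal.exists_ideal_over_maximal_of_isIntegral`) ([MumfordAV1970] §12 Thm. 1 (A) «`π` surjective, locally free»;
[SGA3I] V 4.1 (iv)). [cite: MumfordAV1970, §12 Thm. 1 (A) p. 111] -/
theorem faithfullyFlat_invariants [Algebra.FiniteType R C]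
    (hcoassoc : ∀ c : C, TensorProduct.map LinearMap.id (Coalgebra.comul (R := R) (A := H)) (ρ c) =
      TensorProduct.assoc R C H H (TensorProduct.map ρ.toLinearMap LinearMap.id (ρ c)))
    (hcounit : ∀ c : C, TensorProduct.rid R C
      (TensorProduct.map LinearMap.id (Coalgebra.counit (R := R) (A := H)) (ρ c)) = c)
    (hfree : Function.Surjective
      (Algebra.TensorProduct.productMap (Algebra.TensorProduct.includeLeft : C →ₐ[R] C ⊗[R] H) ρ)) :
    Module.FaithfullyFlat (AlgHom.equalizer ρ (Algebra.TensorProduct.includeLeft : C →ₐ[R] C ⊗[R] H)) C := by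
  haveI : Module.Flat (AlgHom.equalizer ρ (Algebra.TensorProduct.includeLeft : C →ₐ[R] C ⊗[R] H)) C := flat_invariants ρ hcoassoc hcounit hfree
  haveI : Algebra.IsIntegral (AlgHom.equalizer ρ (Algebra.TensorProduct.includeLeft : C →ₐ[R] C ⊗[R] H)) C := algebraIsIntegral_invariants ρ hcoassoc hcounit
  refine ⟨fun 𝔪 h𝔪 htop => ?_⟩
  have hker : RingHom.ker (algebraMap (AlgHom.equalizer ρ (Algebra.TensorProduct.includeLeft : C →ₐ[R] C ⊗[R] H)) C) ≤ 𝔪 := by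
    rw [(RingHom.injective_iff_ker_eq_bot _).1 (fun a b h => Subtype.ext h)]
    exact bot_le
  obtain ⟨Q, hQmax, hQ⟩ := Ideal.exists_ideal_over_maximal_of_isIntegral 𝔪 hker
  have hle : 𝔪.map (algebraMap (AlgHom.equalizer ρ (Algebra.TensorProduct.includeLeft : C →ₐ[R] C ⊗[R] H)) C) ≤ Q := Ideal.map_le_iff_le_comap.2 hQ.ge
  rw [Ideal.smul_top_eq_map, Submodule.restrictScalars_eq_top_iff] at htop
  exact hQmax.ne_top (top_le_iff.1 (htop ▸ hle))

/-- **«FFGS-QUOT» (A), CONJUNCTS 1–2: `X → X ⧸ Z = Spec C₀` IS FINITE AND FAITHFULLY FLAT** — `Module.Finite C₀ C ∧ Module.FaithfullyFlat C₀ C` for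
`C₀ = AlgHom.equalizer ρ includeLeft`, `H` finite free, `C` of finite type, the coaction coassociative, counital and free ([MumfordAV1970] §12 Thm. 1 (A);
[SGA3I] Exp. V Thm. 4.1 (ii)+(iv); [StacksProject] Tag 03BM).  This is `sig_FFGSQ_A_torsorOverInvariants` of the P6b signature sheet minus its third conjunct
(★ locally: §D), under `[Module.Free R H] [Module.Finite R H]` + `[Algebra.FiniteType R C]` in place of `[Module.Finite R H] [Module.Flat R H] [IsNoetherianRing R]`.
[cite: MumfordAV1970, §12 Thm. 1 (A) p. 111] -/
theorem finite_faithfullyFlat_invariants [Algebra.FiniteType R C]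
    (hcoassoc : ∀ c : C, TensorProduct.map LinearMap.id (Coalgebra.comul (R := R) (A := H)) (ρ c) =
      TensorProduct.assoc R C H H (TensorProduct.map ρ.toLinearMap LinearMap.id (ρ c)))
    (hcounit : ∀ c : C, TensorProduct.rid R C
      (TensorProduct.map LinearMap.id (Coalgebra.counit (R := R) (A := H)) (ρ c)) = c)
    (hfree : Function.Surjective
      (Algebra.TensorProduct.productMap (Algebra.TensorProduct.includeLeft : C →ₐ[R] C ⊗[R] H) ρ)) :
    Module.Finite (AlgHom.equalizer ρ (Algebra.TensorProduct.includeLeft : C →ₐ[R] C ⊗[R] H)) C ∧ Module.FaithfullyFlat (AlgHom.equalizer ρ (Algebra.TensorProduct.includeLeft : C →ₐ[R] C ⊗[R] H)) C :=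
  ⟨finite_invariants ρ hcoassoc hcounit, faithfullyFlat_invariants ρ hcoassoc hcounit hfree⟩

end Main

end Literature.AlgebraicGeometry.GroupSchemes.FiniteFlatQuotientAffine
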